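import Summits.ABC.IUTFork.Joshi.ATS4MainBoundsGenuine
import Summits.ABC.IUTFork.Joshi.ATS4LogDiffConductorWildWitness
import Literature.IUT.LogVolume.DistinguishedPrimesBound
import Mathlib.NumberTheory.NumberField.Cyclotomic.Ideal
import Mathlib.NumberTheory.Cyclotomic.Gal
import HarnessLib

/-!
# Sub-cyclotomic towers `ℚ ⊆ K ⊆ ℚ(ζ_ℓ)`: ramification, a lower bound for `log(d^K)`, Tate-divisor data of local height `1` —
# SUPPLY for the R-J census word ⟨WildBoundLp⟩ (row Y-21x; decided in `Joshi/TestATS4WildBoundLpGenuineCensus.lean`)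

Proof-only supply file of the abc-iut cell (block E, R-J «Joshi Y-discharge census», rung LADDER-ABC:A2.RESCUE.J; seat abc-iut-E-t28,
sub-claim Y-21x/MBD3). **No side is taken** on [IUTchIII] Cor. 3.12, on [IUTchIV] Thm. 1.10, on Joshi's claims ([J-IV] =
arXiv:2403.10430v2, unrefereed) or on Mochizuki's reports on them; typed ≠ proved ≠ endorsed; NO abc claim. Everything here is classical
algebraic number theory over Mathlib's `IsCyclotomicExtension.Rat.*` (ramification in `ℚ(ζ_ℓ)`), `pow_sub_one_dvd_differentIdeal`
(Dedekind's `𝔭^{e−1} ∣ 𝔡`) and the tree's arithmetic-divisor bookkeeping (`Literature.IUT.LogVolume`), in the vocabulary of slot T-26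
(`TateDivisorDatum`, `relRamIdx`, `logDifferent`) and slot T-30 (`MainBoundDatum.ofGenuine`).

WHAT IS PROVED (for a prime `ℓ`, `M` any `ℓ`-th cyclotomic extension of `ℚ`, `K` any number field with an embedding `K → M`):
* §1 `[M:ℚ] = ℓ − 1`; `Gal(M/ℚ)` is commutative (`IsPrimitiveRoot.autToPow_injective`), so every cyclic subgroup is normal; for odd `ℓ`
  it has an element of order `2` (Cauchy); `e = ℓ − 1` above `ℓ` and `e = 1` elsewhere (Mathlib).
* §2 `K/ℚ` is UNRAMIFIED at every place of residue characteristic `≠ ℓ` and TOTALLY RAMIFIED at `ℓ` (`e(𝔭|ℓ) = [K:ℚ]`), by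
  multiplicativity of ramification indices in `ℚ ⊆ K ⊆ M` (`Ideal.ramificationIdx_tower`) against §1 and `e ≤` degree; hence
  **`([K:ℚ] − 1)·log ℓ ≤ [K:ℚ]·log(d^K)`** (`finrank_sub_one_mul_log_le_finrank_mul_logDifferent`: `𝔭^{[K:ℚ]−1} ∣ 𝔡_{K/ℤ}`,
  `N(𝔭) ≥ ℓ`, effectivity of the different divisor).
* §3 Tate-divisor data (T-26) all of whose local heights are `1`: `log(𝔣) = log(𝔮)`; over a fibred support on which `K/F` is unramified
  they are in T-26's base-change relation and `log(𝔣_K) = log(𝔣_F)` (Prop. 4.4.4 `prop444`); nonempty support ⇒ `log(𝔮) > 0`;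
  `log(d^ℚ) = 0`.
* §4 the real inequalities `d·log d < (d − 1)·log ℓ` for `2 ≤ d`, `2d + 1 ≤ ℓ` (from `d^d < ℓ^{d−1}` in `ℕ`) and
  `(ℓ − 2)·log ℓ ≤ (ℓ − 1)·log(ℓ − 1)` for `ℓ ≥ 4`.
Theorems only (no `def`, `instance`, notation or new `Prop` fact); standard axioms; no `sorry`. FACT-LIST rows used: none.
[claim: Joshi2024ATS4, status: disputed] (provenance of the vocabulary `TateDivisorDatum` / `logDifferent` only; nothing of the paper is
asserted here).
-/

noncomputable section

open NumberField IsDedekindDomain Module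
open Literature.IUT.LogVolume

namespace Summit.ABC.IUTFork.Joshi.ATS4

namespace WildBoundLpCensus

/-! ## 1. The cyclotomic field `ℚ(ζ_ℓ)`: degree, abelian Galois group, an automorphism of order `2` -/

section Cyclotomic

variable (ℓ : ℕ) [hℓ : Fact ℓ.Prime] (M : Type*) [Field M] [NumberField M] [IsCyclotomicExtension {ℓ} ℚ M]

/-- `[ℚ(ζ_ℓ) : ℚ] = ℓ − 1`. [folklore] -/
theorem finrank_rat_eq : Module.finrank ℚ M = ℓ - 1 := by
  haveI : NeZero ℓ := ⟨hℓ.out.ne_zero⟩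
  rw [IsCyclotomicExtension.finrank M (Polynomial.cyclotomic.irreducible_rat hℓ.out.pos), Nat.totient_prime hℓ.out]

/-- `Gal(ℚ(ζ_ℓ)/ℚ)` is commutative (it embeds into `(ℤ/ℓ)ˣ`, Mathlib `IsPrimitiveRoot.autToPow_injective`). [folklore] -/
theorem aut_mul_comm (ℓ : ℕ) [Fact ℓ.Prime] (M : Type*) [Field M] [NumberField M] [IsCyclotomicExtension {ℓ} ℚ M]
    (a b : M ≃ₐ[ℚ] M) : a * b = b * a := by
  haveI : NeZero ℓ := ⟨(Fact.out : ℓ.Prime).ne_zero⟩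
  apply IsPrimitiveRoot.autToPow_injective (K := ℚ) (IsCyclotomicExtension.zeta_spec ℓ ℚ M)
  rw [map_mul, map_mul, mul_comm]

/-- Every subgroup of the abelian group `Gal(ℚ(ζ_ℓ)/ℚ)` generated by one element is normal. [folklore] -/
theorem zpowers_normal (ℓ : ℕ) [Fact ℓ.Prime] (M : Type*) [Field M] [NumberField M] [IsCyclotomicExtension {ℓ} ℚ M]
    (σ : M ≃ₐ[ℚ] M) : (Subgroup.zpowers σ).Normal :=
  ⟨fun n hn g => by rw [aut_mul_comm ℓ M g n, mul_inv_cancel_right]; exact hn⟩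

/-- `|Gal(ℚ(ζ_ℓ)/ℚ)| = ℓ − 1`. [folklore] -/
theorem card_aut_eq : Nat.card (M ≃ₐ[ℚ] M) = ℓ - 1 := by
  haveI : NeZero ℓ := ⟨hℓ.out.ne_zero⟩
  haveI := IsCyclotomicExtension.isGalois {ℓ} ℚ M
  rw [IsGalois.card_aut_eq_finrank, finrank_rat_eq ℓ M]

/-- For `ℓ` odd, `Gal(ℚ(ζ_ℓ)/ℚ)` has an element of order `2` (Cauchy). [folklore] -/
theorem exists_orderOf_eq_two (h3 : 3 ≤ ℓ) : ∃ σ : M ≃ₐ[ℚ] M, orderOf σ = 2 := by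
  refine exists_prime_orderOf_dvd_card' 2 ?_
  rw [card_aut_eq ℓ M]
  have hodd : Odd ℓ := hℓ.out.odd_of_ne_two (by omega)
  obtain ⟨k, hk⟩ := hodd
  exact ⟨k, by omega⟩

/-! ### Ramification of `ℚ(ζ_ℓ)/ℚ`: index `ℓ − 1` above `ℓ`, `1` elsewhere (Mathlib) -/

/-- Above `ℓ`: `e(w | ℓ) = ℓ − 1`. [folklore] -/
theorem ramificationIdx_int_eq_of_residueChar_eq (w : HeightOneSpectrum (𝓞 M)) (hw : residueChar M w = ℓ) :
    w.asIdeal.ramificationIdx ℤ = ℓ - 1 := by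
  haveI := w.isPrime
  haveI : w.asIdeal.LiesOver (Ideal.span {((ℓ : ℕ) : ℤ)}) := by rw [← hw]; exact liesOver_residueChar M w
  exact IsCyclotomicExtension.Rat.ramificationIdx_eq_of_prime ℓ M w.asIdeal

/-- Away from `ℓ`: `e(w | p_w) = 1`. [folklore] -/
theorem ramificationIdx_int_eq_one_of_residueChar_ne (w : HeightOneSpectrum (𝓞 M)) (hw : residueChar M w ≠ ℓ) :
    w.asIdeal.ramificationIdx ℤ = 1 := by
  haveI := w.isPrime
  haveI : NeZero ℓ := ⟨hℓ.out.ne_zero⟩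
  haveI : Fact (residueChar M w).Prime := ⟨residueChar_prime M w⟩
  have hnd : ¬ residueChar M w ∣ ℓ := fun hd =>
    hw ((Nat.prime_dvd_prime_iff_eq (residueChar_prime M w) hℓ.out).mp hd)
  exact IsCyclotomicExtension.Rat.ramificationIdx_eq_of_not_dvd (m := ℓ) (residueChar M w) M w.asIdeal hnd

end Cyclotomic

/-! ## 2. A number field `K` mapping into `ℚ(ζ_ℓ)`: unramified away from `ℓ`, totally ramified at `ℓ`, different bounded below -/

section SubTower

variable (ℓ : ℕ) [hℓ : Fact ℓ.Prime] (M : Type*) [Field M] [NumberField M] [IsCyclotomicExtension {ℓ} ℚ M]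
variable (K : Type*) [Field K] [NumberField K] [Algebra K M]

omit hℓ [IsCyclotomicExtension {ℓ} ℚ M] in
/-- Over every finite place `u` of `K` lies a finite place of `M ⊇ K` (integrality of `𝓞 M` over `𝓞 K`). [folklore] -/
theorem exists_finBelow_eq (u : HeightOneSpectrum (𝓞 K)) : ∃ U : HeightOneSpectrum (𝓞 M), finBelow K M U = u := by
  haveI := u.isMaximal
  obtain ⟨W, hWmax, hWover⟩ := Ideal.exists_maximal_ideal_liesOver_of_isIntegral (S := 𝓞 M) u.asIdeal
  have hW : W ≠ ⊥ := Ring.ne_bot_of_isMaximal_of_not_isField hWmax (RingOfIntegers.not_isField M)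
  exact ⟨⟨W, hWmax.isPrime, hW⟩, HeightOneSpectrum.ext hWover.over.symm⟩

/-- Every number field has a finite place of residue characteristic `p`, for every prime `p`. [folklore] -/
theorem exists_residueChar_eq (F : Type*) [Field F] [NumberField F] {p : ℕ} (hp : p.Prime) :
    ∃ u : HeightOneSpectrum (𝓞 F), residueChar F u = p := by
  haveI : Fact p.Prime := ⟨hp⟩
  haveI : (Ideal.span {(p : ℤ)}).IsMaximal := Int.ideal_span_isMaximal_of_prime p
  obtain ⟨W, hWmax, hWover⟩ := Ideal.exists_maximal_ideal_liesOver_of_isIntegral (S := 𝓞 F) (Ideal.span {(p : ℤ)})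
  have hW : W ≠ ⊥ := Ring.ne_bot_of_isMaximal_of_not_isField hWmax (RingOfIntegers.not_isField F)
  refine ⟨⟨W, hWmax.isPrime, hW⟩, ?_⟩
  change Ideal.absNorm (Ideal.under ℤ W) = p
  rw [← hWover.over, Ideal.absNorm_span_natCast, Module.finrank_self, pow_one]

include M in
/-- **`K ⊆ ℚ(ζ_ℓ)` is unramified away from `ℓ`**: `e(u | p_u) = 1` for every finite place `u` of `K` of residue characteristic `≠ ℓ`
(multiplicativity `e(U|p) = e(u|p)·e(U|u)` under a place `U` of `ℚ(ζ_ℓ)` over `u`, and `e(U|p) = 1`). [folklore] -/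
theorem ramificationIdx_int_eq_one_of_residueChar_ne' (u : HeightOneSpectrum (𝓞 K)) (hu : residueChar K u ≠ ℓ) :
    u.asIdeal.ramificationIdx ℤ = 1 := by
  obtain ⟨U, hU⟩ := exists_finBelow_eq M K u
  have hres : residueChar M U ≠ ℓ := by
    rw [← residueChar_finBelow (F := K) (K := M) U, hU]; exact hu
  have htower := Ideal.ramificationIdx_tower (R := ℤ) (finBelow K M U).asIdeal U.asIdeal
  rw [ramificationIdx_int_eq_one_of_residueChar_ne ℓ M U hres, hU] at htower
  exact Nat.eq_one_of_mul_eq_one_right htower.symm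

/-- **`K ⊆ ℚ(ζ_ℓ)` is totally ramified at `ℓ`**: `e(u | ℓ) = [K : ℚ]` for every finite place `u` of `K` over `ℓ` (from `e(U|ℓ) = ℓ − 1 =
[K:ℚ]·[ℚ(ζ_ℓ):K]`, `e(u|ℓ) ≤ [K:ℚ]`, `e(U|u) ≤ [ℚ(ζ_ℓ):K]`). [folklore] -/
theorem ramificationIdx_int_eq_finrank_of_residueChar_eq [IsScalarTower ℚ K M] (u : HeightOneSpectrum (𝓞 K))
    (hu : residueChar K u = ℓ) : u.asIdeal.ramificationIdx ℤ = Module.finrank ℚ K := by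
  obtain ⟨U, hU⟩ := exists_finBelow_eq M K u
  have hres : residueChar M U = ℓ := by
    rw [← residueChar_finBelow (F := K) (K := M) U, hU]; exact hu
  have htower := Ideal.ramificationIdx_tower (R := ℤ) (finBelow K M U).asIdeal U.asIdeal
  rw [ramificationIdx_int_eq_of_residueChar_eq ℓ M U hres, hU] at htower
  have heU : U.asIdeal.ramificationIdx (𝓞 K) ≤ Module.finrank K M := by
    rw [← LogDiffCond.relRamIdx_eq K M U]; exact LogDiffCond.relRamIdx_le_finrank K M U
  have heu : u.asIdeal.ramificationIdx ℤ ≤ Module.finrank ℚ K := by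
    rw [← LogDiffCond.relRamIdx_rat_eq K u]; exact LogDiffCond.relRamIdx_le_finrank ℚ K u
  have hdeg : Module.finrank ℚ K * Module.finrank K M = ℓ - 1 := by
    rw [Module.finrank_mul_finrank, finrank_rat_eq ℓ M]
  have hm : 0 < Module.finrank K M := Module.finrank_pos
  refine le_antisymm heu (Nat.le_of_mul_le_mul_right ?_ hm)
  calc Module.finrank ℚ K * Module.finrank K M
      = u.asIdeal.ramificationIdx ℤ * U.asIdeal.ramificationIdx (𝓞 K) := by rw [hdeg, htower]
    _ ≤ u.asIdeal.ramificationIdx ℤ * Module.finrank K M := Nat.mul_le_mul_left _ heU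

/-- **The different of `K ⊆ ℚ(ζ_ℓ)` is bounded below at `ℓ`**: `([K:ℚ] − 1)·log ℓ ≤ [K:ℚ]·log(d^K)`, i.e. `log(d^K) ≥ (1 − 1/[K:ℚ])·log ℓ`
— from `𝔭^{e−1} ∣ 𝔡_{K/ℤ}` (Mathlib `pow_sub_one_dvd_differentIdeal`, tree `ramificationIdx_int_sub_one_le_multiplicity`) at a place `𝔭`
over `ℓ`, `e(𝔭|ℓ) = [K:ℚ]`, `N(𝔭) ≥ ℓ`, and effectivity of the different divisor. (Equality holds, `K/ℚ` being tame at `ℓ` and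
unramified elsewhere; only `≥` is used.) [folklore] -/
theorem finrank_sub_one_mul_log_le_finrank_mul_logDifferent [IsScalarTower ℚ K M] :
    ((Module.finrank ℚ K : ℝ) - 1) * Real.log ℓ ≤ Module.finrank ℚ K * logDifferent K := by
  obtain ⟨u, hu⟩ := exists_residueChar_eq K hℓ.out
  set d := Module.finrank ℚ K with hd
  have hd1 : 1 ≤ d := Module.finrank_pos
  have hd0 : (0 : ℝ) < d := by exact_mod_cast hd1
  have he := ramificationIdx_int_eq_finrank_of_residueChar_eq ℓ M K u hu
  have hmult : d - 1 ≤ multiplicity u.asIdeal (differentIdeal ℤ (𝓞 K)) := by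
    have h := ramificationIdx_int_sub_one_le_multiplicity u
    rwa [he] at h
  have hcoef : (d : ℝ) - 1 ≤ differentDivisor K (Sum.inr u) := by
    rw [differentDivisor_apply_inr]
    have h : ((d - 1 : ℕ) : ℝ) ≤ (multiplicity u.asIdeal (differentIdeal ℤ (𝓞 K)) : ℝ) := by exact_mod_cast hmult
    rwa [Nat.cast_sub hd1, Nat.cast_one] at h
  have hlog0 : 0 ≤ Real.log ℓ := Real.log_nonneg (by exact_mod_cast hℓ.out.one_lt.le)
  have hnorm : Real.log ℓ ≤ logNorm K u := by
    rw [logNorm_eq, hu]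
    have hf : (1 : ℝ) ≤ resDeg K u := by exact_mod_cast Nat.one_le_iff_ne_zero.mpr (resDeg_ne_zero K u)
    nlinarith
  have hdeg : differentDivisor K (Sum.inr u) * logNorm K u ≤ degF K (differentDivisor K) := by
    have h := sum_inr_mul_logNorm_le_degF (differentDivisor_isEffective K) {u}
    rwa [Finset.sum_singleton] at h
  have hndeg : (d : ℝ) * logDifferent K = degF K (differentDivisor K) := by
    rw [logDifferent, ndeg_apply, ← hd]
    field_simp
  rw [hndeg]
  have hd1' : (1 : ℝ) ≤ d := by exact_mod_cast hd1
  calc ((d : ℝ) - 1) * Real.log ℓ ≤ differentDivisor K (Sum.inr u) * logNorm K u :=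
        mul_le_mul hcoef hnorm hlog0 (by linarith)
    _ ≤ degF K (differentDivisor K) := hdeg

end SubTower

/-! ## 3. Tate-divisor data with all local heights `1`: `log(𝔣) = log(𝔮)`, base change, positivity; `log(d^ℚ) = 0` -/

section Data

variable {F : Type*} [Field F] [NumberField F]

/-- If every `ord_w(q_w) = 1` on the support, the reduced Tate divisor IS the Tate divisor: `log(𝔣_F) = log(𝔮_F)`. [folklore] -/
theorem logf_eq_logq_of_ordq_eq_one (𝔮 : TateDivisorDatum F) (h : ∀ w ∈ 𝔮.V, 𝔮.ordq w = 1) : 𝔮.logf = 𝔮.logq := by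
  rw [TateDivisorDatum.logf_eq_sum, TateDivisorDatum.logq_eq_sum]
  congr 1
  refine Finset.sum_congr rfl fun w hw => ?_
  rw [h w hw, Nat.cast_one, one_mul]

/-- A Tate divisor with nonempty support has `log(𝔮_F) > 0`. [folklore] -/
theorem logq_pos_of_nonempty (𝔮 : TateDivisorDatum F) (h : 𝔮.V.Nonempty) : 0 < 𝔮.logq := by
  rw [TateDivisorDatum.logq_eq_sum]
  refine div_pos (Finset.sum_pos (fun w hw => ?_) h) (by exact_mod_cast Module.finrank_pos)
  have h1 : (1 : ℝ) ≤ 𝔮.ordq w := by exact_mod_cast 𝔮.ordq_pos w hw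
  nlinarith [logNorm_pos F w]

variable {K : Type*} [Field K] [NumberField K] [Algebra F K]

/-- Data with all local heights `1` over a fibred support are in T-26's base-change relation as soon as `K/F` is unramified on the
support. [folklore] -/
theorem isBaseChangeOf_of_relRamIdx_eq_one (𝔮 : TateDivisorDatum F) (𝔮K : TateDivisorDatum K)
    (hV : ∀ u, u ∈ 𝔮K.V ↔ finBelow F K u ∈ 𝔮.V) (h1 : ∀ v ∈ 𝔮.V, 𝔮.ordq v = 1) (h1K : ∀ u ∈ 𝔮K.V, 𝔮K.ordq u = 1)
    (hunr : ∀ u ∈ 𝔮K.V, relRamIdx F K u = 1) : 𝔮K.IsBaseChangeOf 𝔮 :=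
  ⟨hV, fun u hu => by rw [h1 _ hu, h1K u ((hV u).mpr hu), hunr u ((hV u).mpr hu)]⟩

/-- … and then `log(𝔣_K) = log(𝔣_F)` (both equal `log(𝔮)`, invariant under base change: T-26's Prop. 4.4.4 `prop444`). [folklore] -/
theorem logf_eq_logf_of_relRamIdx_eq_one (𝔮 : TateDivisorDatum F) (𝔮K : TateDivisorDatum K)
    (hV : ∀ u, u ∈ 𝔮K.V ↔ finBelow F K u ∈ 𝔮.V) (h1 : ∀ v ∈ 𝔮.V, 𝔮.ordq v = 1) (h1K : ∀ u ∈ 𝔮K.V, 𝔮K.ordq u = 1)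
    (hunr : ∀ u ∈ 𝔮K.V, relRamIdx F K u = 1) : 𝔮K.logf = 𝔮.logf := by
  rw [logf_eq_logq_of_ordq_eq_one 𝔮K h1K, logf_eq_logq_of_ordq_eq_one 𝔮 h1,
    TateDivisorDatum.prop444 𝔮K 𝔮 (isBaseChangeOf_of_relRamIdx_eq_one 𝔮 𝔮K hV h1 h1K hunr)]

/-- `log(d^ℚ) = 0` (`disc ℚ = 1`). [folklore] -/
theorem logDifferent_rat : logDifferent ℚ = 0 := by
  rw [logDifferent_eq_log_discr, Rat.numberField_discr]
  simp

end Data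

/-! ## 4. The elementary inequalities -/

section Numeric

/-- `d^d < ℓ^{d−1}` for `2 ≤ d`, `2d + 1 ≤ ℓ` (`d ≤ 2^{d−1}`, so `d^d ≤ (2d)^{d−1} < ℓ^{d−1}`). [folklore] -/
theorem pow_self_lt_pow_pred {d ℓ : ℕ} (hd : 2 ≤ d) (hℓ : 2 * d + 1 ≤ ℓ) : d ^ d < ℓ ^ (d - 1) := by
  obtain ⟨k, rfl⟩ : ∃ k, d = k + 1 := ⟨d - 1, by omega⟩
  have hk : k ≠ 0 := by omega
  rw [Nat.add_sub_cancel]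
  have h2 : k + 1 ≤ 2 ^ k := Nat.lt_two_pow_self (n := k)
  calc (k + 1) ^ (k + 1) = (k + 1) * (k + 1) ^ k := by rw [pow_succ']
    _ ≤ 2 ^ k * (k + 1) ^ k := Nat.mul_le_mul_right _ h2
    _ = (2 * (k + 1)) ^ k := by rw [mul_pow]
    _ < ℓ ^ k := Nat.pow_lt_pow_left (by omega) hk

/-- `d·log d < (d − 1)·log ℓ` for `2 ≤ d`, `2d + 1 ≤ ℓ`. [folklore] -/
theorem mul_log_lt_sub_one_mul_log {d ℓ : ℕ} (hd : 2 ≤ d) (hℓ : 2 * d + 1 ≤ ℓ) :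
    (d : ℝ) * Real.log d < ((d : ℝ) - 1) * Real.log ℓ := by
  have h := pow_self_lt_pow_pred hd hℓ
  have hcast : (d : ℝ) ^ d < (ℓ : ℝ) ^ (d - 1) := by exact_mod_cast h
  have hdpos : (0 : ℝ) < (d : ℝ) ^ d := by positivity
  have hlog := Real.log_lt_log hdpos hcast
  rw [Real.log_pow, Real.log_pow, Nat.cast_sub (by omega : 1 ≤ d), Nat.cast_one] at hlog
  exact hlog

/-- `(ℓ − 2)·log ℓ ≤ (ℓ − 1)·log(ℓ − 1)` for `4 ≤ ℓ` (`log(1 + 1/n) ≤ 1/n` and `log n ≥ 1` for `n = ℓ − 1 ≥ 3`). [folklore] -/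
theorem sub_two_mul_log_le {ℓ : ℕ} (h4 : 4 ≤ ℓ) :
    ((ℓ : ℝ) - 2) * Real.log ℓ ≤ ((ℓ : ℝ) - 1) * Real.log ((ℓ : ℝ) - 1) := by
  have hℓ4 : (4 : ℝ) ≤ ℓ := by exact_mod_cast h4
  obtain ⟨n, hn_def, hn⟩ : ∃ n : ℝ, (ℓ : ℝ) = n + 1 ∧ 3 ≤ n := ⟨(ℓ : ℝ) - 1, by ring, by linarith⟩
  have hn0 : 0 < n := by linarith
  -- `log(n+1) ≤ log n + 1/n`
  have h1 : Real.log (n + 1) ≤ Real.log n + 1 / n := by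
    have hx : 0 < (n + 1) / n := by positivity
    have h := Real.log_le_sub_one_of_pos hx
    rw [Real.log_div (by linarith) hn0.ne'] at h
    have e : (n + 1) / n - 1 = 1 / n := by rw [add_div, div_self hn0.ne', add_sub_cancel_left]
    linarith
  -- `1 ≤ log n` for `n ≥ 3 > e`
  have h2 : 1 ≤ Real.log n := by
    rw [Real.le_log_iff_exp_le hn0]
    have := Real.exp_one_lt_d9
    linarith
  rw [hn_def, show n + 1 - 2 = n - 1 by ring, show n + 1 - 1 = n by ring]
  have h3 : (n - 1) * Real.log (n + 1) ≤ (n - 1) * (Real.log n + 1 / n) :=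
    mul_le_mul_of_nonneg_left h1 (by linarith)
  have h4' : (n - 1) * (Real.log n + 1 / n) = n * Real.log n - Real.log n + (n - 1) / n := by
    rw [mul_add, sub_mul, one_mul, mul_one_div]
  have h5 : (n - 1) / n ≤ 1 := by rw [div_le_one hn0]; linarith
  linarith

end Numeric

end WildBoundLpCensus

end Summit.ABC.IUTFork.Joshi.ATS4

end
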